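import Summits.QuantumAdvantage.QuantumAdvantage.Theorems.SosSandwichPseudoBoundedAAGradientBound
import Summits.QuantumAdvantage.QuantumAdvantage.Theorems.SosSandwichPseudoBoundedAALevelKRows
import HarnessLib

/-!
# Route `SosSandwich`, crux `PseudoBoundedAA` (stmt-QuantumAdvantage-15237): the SHARP VARIANCE EXPONENT at every
# degree — `maxᵢ Infᵢ[p] ≥ 4·Var[p]² / (9^d·d⁴)` for every `[0,1]`-valued `p` of degree `≤ d`

PB-AA asks for `maxᵢ Infᵢ[p] ≥ C (ε/T)^c` on `K_T` with constants uniform in `T`; the card predicts `c = 2` and `c ≥ 2`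
is forced (`…HomogeneousPBAATExponent`, `…MeanSquareAlg`).  The tree's unconditional fixed-degree bound is the discharged
DFKO fact with `Var³/2^{21d}`; the level rungs (`…LevelOneRung`, `…LevelTwoRung`, `…QueryAAQTwoQueries`) reach the
exponent `2` for `≤ 2` queries.  This file proves the exponent `2` at EVERY degree, level-free:
1. (`…PseudoBoundedAAGradientBound`) ℓ¹-sensitivity `Σ_i |p(x) - p(x^{⊕i})| ≤ 2d²` at every vertex (Markov);
2. (`two_pow_mul_sqrt_influence_le`) Hölder + Bonami at degree `d` (tree `LevelKRung.sq_sum_le_of_isLevelLE`,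
   `IsLevelLE.bonami_even_moment`): `‖u‖₂ ≤ 3^d ‖u‖₁` for `u_i = p - p^{⊕i}`, so (`sum_sqrt_influence_le`)
   **`Σ_i √Inf_i[p] ≤ 2·3^d·d²`**;
3. (`exists_influence_ge_var_sq`) Poincaré `4·Var ≤ Σ_i Inf_i ≤ √maxInf · Σ_i √Inf_i`,
   hence **`∃ i, 4·Var[p]² ≤ 9^d·d⁴·Inf_i[p]`**.
Corollaries (§4): `influence_bound_var_sq` — the DFKO-shaped bound with `(a, C) = (2, 8)`
(the tree's discharge has `a = 3`); `exists_influence_ge_var_sq_pseudoBounded` — on `K_T`: `Var² ≤ 4·81^T·T⁴·maxInf`;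
`pseudoBoundedAA_of_order_le_sharp`, `aaQuery_var_sq`, `aaQuery_of_queries_le_sharp` — PB-AA's and `AA_Q`'s conclusion
with the OPTIMAL `c = 2` on every bounded range `T ≤ T₀` (tree: `T₀ = 2` via the rungs, general `T₀` only with the
DFKO exponent).  So at every fixed degree the ε-exponent is exactly `2`; the whole open content of the crux is the
growth of the constant in `T` (`9^{2T}(2T)⁴` here versus the conjectured `poly(T)`; §4 isolates the loss-free part
`4·Var ≤ 2d²·E_x maxᵢ|p − p^{⊕i}|` (`four_mul_boolVariance_le_avg_maxFlip`); `Σ_i √Inf_i` itself can be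
`2^{Ω(d)}` — e.g. the address function, not treated here — so step 2 is where this chain loses exponentially).

Honest label: support lemmas (new unconditional bound, sharp in `ε`, exponential in `d`); no stub, crux or summit is
proved.  Sources: O'Donnell 2014 Thm. 9.21, §2.2–2.4; Korneichuk 1991 Thm. 3.5.8; Dinur–Friedgut–Kindler–O'Donnell 2007
Thm. 3; Aaronson–Ambainis 2014 Conj. 6 and p. 6; Beals et al. 2001 Lemma 4.2.
-/

-- D-0017: single-conjunct summit ⇒ the duplicate `QuantumAdvantage.QuantumAdvantage` is mandated.
set_option linter.dupNamespace false

noncomputable section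

namespace Summit.QuantumAdvantage.QuantumAdvantage.Theorems.SosSandwich.VarianceSquared

open Finset
open Literature.Computability.QuantumComplexity
open Literature.Computability.Complexity.LowDegree (cubeFourierCoeff sum_cubeFourierCoeff_mul_walsh
  sum_walsh_mul_walsh_index IsLevelLE tailWeight cubeFourierCoeff_sum_mul_walsh)
open Literature.Probability.RandomGraphs.LowDegree (sgn walsh sgn_true sgn_false walsh_empty)
open Literature.Computability.Cryptography (QQueryAlg)
open Summit.QuantumAdvantage.QuantumAdvantage.Theorems.SosSandwich.GradientBound

variable {N : ℕ}

/-! ### §1 `Σ_i √Inf_i[p] ≤ 2·3^d·d²` (Hölder + Bonami at degree `d`: tree `LevelKRung.sq_sum_le_of_isLevelLE`) -/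

/-- The bit-flip difference `x ↦ p(x) - p(x^{⊕i})` of a polynomial of total degree `≤ d` has Fourier degree `≤ d`
(its coefficients are `2 p̂(T) [i ∈ T]`). [cite: ODonnell2014, §2.2] -/
theorem isLevelLE_sub_flipBit {d : ℕ} {p : MvPolynomial (Fin N) ℝ} (hp : p.totalDegree ≤ d) (i : Fin N) :
    IsLevelLE d (fun x => evalBool p x - evalBool p (flipBit i x)) := by
  intro S hS
  have h : (fun x => evalBool p x - evalBool p (flipBit i x)) = fun x =>
      ∑ T : Finset (Fin N), (if i ∈ T then 2 * cubeFourierCoeff (evalBool p) T else 0) * walsh T x :=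
    funext fun x => evalBool_sub_evalBool_flipBit p i x
  rw [h, cubeFourierCoeff_sum_mul_walsh, cubeFourierCoeff_evalBool_eq_zero hp hS]
  simp

/-- **`2^N·√Inf_i[p] ≤ 3^d · Σ_x |p(x) - p(x^{⊕i})|`** for a polynomial of total degree `≤ d`
(`Inf_i = E (p - p^{⊕i})²` and the Hölder–Bonami step at degree `d`). [cite: ODonnell2014, Thm. 9.21, §2.2] -/
theorem two_pow_mul_sqrt_influence_le {d : ℕ} {p : MvPolynomial (Fin N) ℝ} (hp : p.totalDegree ≤ d)
    (i : Fin N) :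
    (2 : ℝ) ^ N * Real.sqrt (influence i p) ≤
      (3 : ℝ) ^ d * ∑ x, |evalBool p x - evalBool p (flipBit i x)| := by
  have key := LevelKRung.sq_sum_le_of_isLevelLE _ (isLevelLE_sub_flipBit hp i)
  have hinf : influence i p = (∑ x, (evalBool p x - evalBool p (flipBit i x)) ^ 2) / (2 : ℝ) ^ N := rfl
  have h2N : (0 : ℝ) < (2 : ℝ) ^ N := by positivity
  have h39 : ((3 : ℝ) ^ d) ^ 2 = (9 : ℝ) ^ d := by rw [← pow_mul, mul_comm, pow_mul]; norm_num
  have hsq : ((2 : ℝ) ^ N * Real.sqrt (influence i p)) ^ 2 ≤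
      ((3 : ℝ) ^ d * ∑ x, |evalBool p x - evalBool p (flipBit i x)|) ^ 2 :=
    calc ((2 : ℝ) ^ N * Real.sqrt (influence i p)) ^ 2
        = (2 : ℝ) ^ N * ((2 : ℝ) ^ N * influence i p) := by
          rw [mul_pow, Real.sq_sqrt (influence_nonneg i p)]; ring
      _ = (∑ x, (evalBool p x - evalBool p (flipBit i x)) ^ 2) * (2 : ℝ) ^ N := by
          rw [hinf, mul_div_cancel₀ _ (ne_of_gt h2N)]; ring
      _ ≤ (9 : ℝ) ^ d * (∑ x, |evalBool p x - evalBool p (flipBit i x)|) ^ 2 := key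
      _ = ((3 : ℝ) ^ d * ∑ x, |evalBool p x - evalBool p (flipBit i x)|) ^ 2 := by
          rw [mul_pow, h39]
  exact (pow_le_pow_iff_left₀ (by positivity) (by positivity) two_ne_zero).mp hsq

/-- **`Σ_i √Inf_i[p] ≤ 2·3^d·d²`** for every real polynomial `p` of total degree `≤ d` with `0 ≤ p ≤ 1` on `{0,1}^N`:
average the ℓ¹-sensitivity bound `Σ_i |p(x) - p(x^{⊕i})| ≤ 2d²` over `x` and apply `two_pow_mul_sqrt_influence_le`.
[cite: ODonnell2014, Thm. 9.21, §2.2] [cite: Korneichuk1991, Thm 3.5.8 (§3.5.4)] -/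
theorem sum_sqrt_influence_le {d : ℕ} {p : MvPolynomial (Fin N) ℝ} (hp : p.totalDegree ≤ d)
    (hb : ∀ x, 0 ≤ evalBool p x ∧ evalBool p x ≤ 1) :
    ∑ i, Real.sqrt (influence i p) ≤ 2 * (3 : ℝ) ^ d * (d : ℝ) ^ 2 := by
  have h2N : (0 : ℝ) < (2 : ℝ) ^ N := by positivity
  have h1 : (2 : ℝ) ^ N * ∑ i, Real.sqrt (influence i p) ≤
      ∑ i, (3 : ℝ) ^ d * ∑ x : Fin N → Bool, |evalBool p x - evalBool p (flipBit i x)| := by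
    rw [Finset.mul_sum]
    exact Finset.sum_le_sum fun i _ => two_pow_mul_sqrt_influence_le hp i
  have h2 : ∑ i, (3 : ℝ) ^ d * ∑ x : Fin N → Bool, |evalBool p x - evalBool p (flipBit i x)| =
      (3 : ℝ) ^ d * ∑ x : Fin N → Bool, ∑ i, |evalBool p x - evalBool p (flipBit i x)| := by
    rw [← Finset.mul_sum, Finset.sum_comm]
  have h3 : ∑ x : Fin N → Bool, ∑ i, |evalBool p x - evalBool p (flipBit i x)| ≤
      (2 : ℝ) ^ N * (2 * (d : ℝ) ^ 2) := by
    calc ∑ x : Fin N → Bool, ∑ i, |evalBool p x - evalBool p (flipBit i x)|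
        ≤ ∑ _x : Fin N → Bool, 2 * (d : ℝ) ^ 2 :=
          Finset.sum_le_sum fun x _ => sum_abs_sub_flipBit_le_of_bounded hp hb x
      _ = (2 : ℝ) ^ N * (2 * (d : ℝ) ^ 2) := by simp [Finset.card_univ, Fintype.card_fin]
  have h4 : (2 : ℝ) ^ N * ∑ i, Real.sqrt (influence i p) ≤ (2 : ℝ) ^ N * (2 * (3 : ℝ) ^ d * (d : ℝ) ^ 2) :=
    calc (2 : ℝ) ^ N * ∑ i, Real.sqrt (influence i p)
        ≤ (3 : ℝ) ^ d * ∑ x : Fin N → Bool, ∑ i, |evalBool p x - evalBool p (flipBit i x)| := h2 ▸ h1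
      _ ≤ (3 : ℝ) ^ d * ((2 : ℝ) ^ N * (2 * (d : ℝ) ^ 2)) := mul_le_mul_of_nonneg_left h3 (by positivity)
      _ = (2 : ℝ) ^ N * (2 * (3 : ℝ) ^ d * (d : ℝ) ^ 2) := by ring
  exact le_of_mul_le_mul_left h4 h2N

/-! ### §2 Poincaré and the main bound `4·Var[p]² ≤ 9^d·d⁴·maxᵢ Infᵢ[p]` -/

/-- **The sharp variance exponent at every degree.**  For a real polynomial `p` of total degree `≤ d` with
`0 ≤ p ≤ 1` on `{0,1}^N`, `N ≥ 1`, some variable has `4·Var[p]² ≤ 9^d·d⁴·Inf_i[p]`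
(`4 Var ≤ Σ Inf_i ≤ √maxInf · Σ √Inf_i ≤ √maxInf · 2·3^d·d²`).  The exponent `2` on `Var` is optimal (the mean
function); the loss in `d` is exponential here, polynomial in the Aaronson–Ambainis conjecture.
[cite: ODonnell2014, Thm. 9.21, §2.2–2.4] [cite: Korneichuk1991, Thm 3.5.8 (§3.5.4)] [cite: AaronsonAmbainis2014, Conj. 6] -/
theorem exists_influence_ge_var_sq {d : ℕ} {p : MvPolynomial (Fin N) ℝ} (hN : 0 < N) (hp : p.totalDegree ≤ d)
    (hb : ∀ x, 0 ≤ evalBool p x ∧ evalBool p x ≤ 1) :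
    ∃ i : Fin N, 4 * boolVariance p ^ 2 ≤ (9 : ℝ) ^ d * (d : ℝ) ^ 4 * influence i p := by
  haveI : Nonempty (Fin N) := Fin.pos_iff_nonempty.mp hN
  obtain ⟨i, -, hi⟩ := Finset.exists_max_image Finset.univ (fun j : Fin N => influence j p)
    Finset.univ_nonempty
  refine ⟨i, ?_⟩
  have hmax : ∀ j, influence j p ≤ influence i p := fun j => hi j (Finset.mem_univ j)
  have hm0 : 0 ≤ influence i p := influence_nonneg i p
  have hsum : ∑ j, influence j p ≤ Real.sqrt (influence i p) * ∑ j, Real.sqrt (influence j p) := by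
    rw [Finset.mul_sum]
    refine Finset.sum_le_sum fun j _ => ?_
    have hj0 := influence_nonneg j p
    calc influence j p = Real.sqrt (influence j p) * Real.sqrt (influence j p) :=
          (Real.mul_self_sqrt hj0).symm
      _ ≤ Real.sqrt (influence i p) * Real.sqrt (influence j p) :=
          mul_le_mul_of_nonneg_right (Real.sqrt_le_sqrt (hmax j)) (Real.sqrt_nonneg _)
  -- Poincaré `4·Var ≤ Σ_i Inf_i` (`Var = Σ_{S≠∅} p̂(S)²`, `Σ_i Inf_i = 4 Σ_S |S| p̂(S)²`; O'Donnell §2.3; the tree's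
  -- `FHKL.four_mul_boolVariance_le_sum_influence`, re-derived inline to keep this file's import cone small)
  have hP : 4 * boolVariance p ≤ ∑ j, influence j p := by
    rw [sum_influence_eq, boolVariance_eq_tailWeight_one, tailWeight]
    refine mul_le_mul_of_nonneg_left ?_ (by norm_num)
    calc ∑ S ∈ univ.filter (fun S : Finset (Fin N) => 1 ≤ S.card), cubeFourierCoeff (evalBool p) S ^ 2
        ≤ ∑ S ∈ univ.filter (fun S : Finset (Fin N) => 1 ≤ S.card),
            (S.card : ℝ) * cubeFourierCoeff (evalBool p) S ^ 2 :=
          Finset.sum_le_sum fun S hS => by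
            have h1 : (1 : ℝ) ≤ S.card := by exact_mod_cast (Finset.mem_filter.1 hS).2
            nlinarith [sq_nonneg (cubeFourierCoeff (evalBool p) S)]
      _ ≤ ∑ S, (S.card : ℝ) * cubeFourierCoeff (evalBool p) S ^ 2 :=
          Finset.sum_le_sum_of_subset_of_nonneg (Finset.filter_subset _ _) fun S _ _ => by positivity
  have hV : 4 * boolVariance p ≤ Real.sqrt (influence i p) * (2 * (3 : ℝ) ^ d * (d : ℝ) ^ 2) :=
    hP.trans (hsum.trans (mul_le_mul_of_nonneg_left (sum_sqrt_influence_le hp hb) (Real.sqrt_nonneg _)))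
  have hV0 : 0 ≤ 4 * boolVariance p := by linarith [boolVariance_nonneg p]
  have hsq := pow_le_pow_left₀ hV0 hV 2
  have h39 : ((3 : ℝ) ^ d) ^ 2 = (9 : ℝ) ^ d := by rw [← pow_mul, mul_comm, pow_mul]; norm_num
  have e : (Real.sqrt (influence i p) * (2 * (3 : ℝ) ^ d * (d : ℝ) ^ 2)) ^ 2 =
      4 * ((9 : ℝ) ^ d * (d : ℝ) ^ 4 * influence i p) := by
    rw [mul_pow, Real.sq_sqrt hm0,
      show (2 * (3 : ℝ) ^ d * (d : ℝ) ^ 2) ^ 2 = 4 * ((3 : ℝ) ^ d) ^ 2 * (d : ℝ) ^ 4 by ring, h39]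
    ring
  have e4 : (4 * boolVariance p) ^ 2 = 4 * (4 * boolVariance p ^ 2) := by ring
  rw [e, e4] at hsq
  linarith

/-! ### §3 Corollaries: the DFKO shape with `a = 2`; `K_T`; `Q_T` -/
/-- `9^d·d⁴ ≤ 2^{8d}`. [folklore] -/
theorem nine_pow_mul_pow_four_le (d : ℕ) : (9 : ℝ) ^ d * (d : ℝ) ^ 4 ≤ (2 : ℝ) ^ (8 * d) := by
  have h1 : (9 : ℝ) ^ d ≤ (16 : ℝ) ^ d := pow_le_pow_left₀ (by norm_num) (by norm_num) d
  have h2 : (d : ℝ) ≤ (2 : ℝ) ^ d := by exact_mod_cast (Nat.lt_two_pow_self).le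
  have h3 : (d : ℝ) ^ 4 ≤ (16 : ℝ) ^ d :=
    calc (d : ℝ) ^ 4 ≤ ((2 : ℝ) ^ d) ^ 4 := pow_le_pow_left₀ (by positivity) h2 4
      _ = (16 : ℝ) ^ d := by rw [← pow_mul, mul_comm, pow_mul]; norm_num
  calc (9 : ℝ) ^ d * (d : ℝ) ^ 4 ≤ (16 : ℝ) ^ d * (16 : ℝ) ^ d :=
        mul_le_mul h1 h3 (by positivity) (by positivity)
    _ = (2 : ℝ) ^ (8 * d) := by rw [← mul_pow, pow_mul]; norm_num

/-- **The Dinur–Friedgut–Kindler–O'Donnell shape with the variance exponent `2`**: for every real polynomial `p` of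
total degree `≤ d` with `0 ≤ p ≤ 1` on `{0,1}^N` and every `0 < ε ≤ Var[p]`, some variable has
`Inf_i[p] ≥ ε² / 2^{8d}` — the body of the tree's `dfko2007_influence_bounded` with `(a, C) = (2, 8)` (its discharge
`dfko2007_influence_bounded_holds` has `(3, 21)`). [cite: DinurEtAl2007, Thm. 3] [cite: AaronsonAmbainis2014, p. 6]
[cite: ODonnell2014, Thm. 9.21] -/
theorem influence_bound_var_sq {d : ℕ} {p : MvPolynomial (Fin N) ℝ} {ε : ℝ} (hp : p.totalDegree ≤ d)
    (hb : ∀ x, 0 ≤ evalBool p x ∧ evalBool p x ≤ 1) (hε : 0 < ε) (hv : ε ≤ boolVariance p) :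
    ∃ i : Fin N, ε ^ 2 / (2 : ℝ) ^ (8 * d) ≤ influence i p := by
  rcases Nat.eq_zero_or_pos N with hN0 | hN
  · exfalso; subst hN0; linarith [show boolVariance p = 0 by simp [boolVariance, boolAvg]]
  obtain ⟨i, hi⟩ := exists_influence_ge_var_sq hN hp hb
  refine ⟨i, ?_⟩
  have hInf := influence_nonneg i p
  have hε2 : ε ^ 2 ≤ boolVariance p ^ 2 := pow_le_pow_left₀ hε.le hv 2
  have h4 : boolVariance p ^ 2 ≤ (9 : ℝ) ^ d * (d : ℝ) ^ 4 * influence i p := by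
    nlinarith [hi, sq_nonneg (boolVariance p)]
  have h5 : (9 : ℝ) ^ d * (d : ℝ) ^ 4 * influence i p ≤ (2 : ℝ) ^ (8 * d) * influence i p :=
    mul_le_mul_of_nonneg_right (nine_pow_mul_pow_four_le d) hInf
  rw [div_le_iff₀ (by positivity)]
  linarith

/-- **On the SOS sandwich class `K_T`**: every pseudo-bounded `p` of order `T` on `N ≥ 1` bits has a variable with
`Var[p]² ≤ 4·81^T·T⁴·Inf_i[p]` (`K_T ∋ p` agrees on the cube with a `[0,1]`-bounded representative of total degree
`≤ 2T`; `9^{2T}(2T)⁴/4 = 4·81^T·T⁴`). [cite: KaniewskiLeeDewolf2015, Def. 7] [cite: ODonnell2014, Thm. 9.21]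
[cite: AaronsonAmbainis2014, Conj. 6] -/
theorem exists_influence_ge_var_sq_pseudoBounded {T : ℕ} {p : MvPolynomial (Fin N) ℝ} (hN : 0 < N)
    (h : PseudoBounded T p) :
    ∃ i : Fin N, boolVariance p ^ 2 ≤ 4 * (81 : ℝ) ^ T * (T : ℝ) ^ 4 * influence i p := by
  obtain ⟨p', hdeg, hb, heq⟩ := exists_representative_of_pseudoBounded h
  obtain ⟨i, hi⟩ := exists_influence_ge_var_sq hN hdeg hb
  refine ⟨i, ?_⟩
  have hinf : influence i p' = influence i p := by unfold influence; rw [heq]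
  have hvar : boolVariance p' = boolVariance p := by unfold boolVariance; rw [heq]
  rw [hinf, hvar] at hi
  have h81 : (9 : ℝ) ^ (2 * T) = (81 : ℝ) ^ T := by rw [pow_mul]; norm_num
  have hcast : ((2 * T : ℕ) : ℝ) ^ 4 = 16 * (T : ℝ) ^ 4 := by push_cast; ring
  rw [h81, hcast] at hi
  linarith

/-- **PB-AA with the optimal ε-exponent on every bounded range of orders.**  For each `T₀`, the conclusion of the
crux `PseudoBoundedAA` holds for all orders `1 ≤ T ≤ T₀` with `c = 2` and `C = 1/(4·81^{T₀}·T₀⁴)`: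
every `p ∈ K_T` with `Var[p] ≥ ε > 0` has a variable with `C·(ε/T)² ≤ Inf_i[p]` (`PseudoBounded`, `boolVariance`,
`influence` are definitionally the route file's inline vocabulary).  The tree's fixed-order bound
`pseudoBoundedAA_of_order_le` has `c = 3`. [cite: AaronsonAmbainis2014, Conj. 6] [cite: ODonnell2014, Thm. 9.21]
[cite: Korneichuk1991, Thm 3.5.8 (§3.5.4)] -/
theorem pseudoBoundedAA_of_order_le_sharp (T₀ : ℕ) :
    ∃ C : ℝ, 0 < C ∧ ∀ (N T : ℕ) (p : MvPolynomial (Fin N) ℝ) (ε : ℝ),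
      T ≤ T₀ → 1 ≤ T → PseudoBounded T p → 0 < ε → ε ≤ boolVariance p →
        ∃ i : Fin N, C * (ε / T) ^ 2 ≤ influence i p := by
  refine ⟨1 / (4 * (81 : ℝ) ^ T₀ * ((T₀ : ℝ) ^ 4 + 1)), by positivity, ?_⟩
  intro N T p ε hT0 hT hPB hε hv
  rcases Nat.eq_zero_or_pos N with hN0 | hN
  · exfalso; subst hN0; linarith [show boolVariance p = 0 by simp [boolVariance, boolAvg]]
  obtain ⟨i, hi⟩ := exists_influence_ge_var_sq_pseudoBounded hN hPB
  refine ⟨i, ?_⟩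
  have hInf := influence_nonneg i p
  have hT1 : (1 : ℝ) ≤ T := by exact_mod_cast hT
  have hTT : (T : ℝ) ≤ T₀ := by exact_mod_cast hT0
  have hεT : (ε / T) ^ 2 ≤ ε ^ 2 :=
    pow_le_pow_left₀ (div_nonneg hε.le (by positivity)) (div_le_self hε.le hT1) 2
  have hε2 : ε ^ 2 ≤ boolVariance p ^ 2 := pow_le_pow_left₀ hε.le hv 2
  have h81 : (81 : ℝ) ^ T ≤ (81 : ℝ) ^ T₀ := pow_le_pow_right₀ (by norm_num) hT0
  have hT4 : (T : ℝ) ^ 4 ≤ (T₀ : ℝ) ^ 4 + 1 :=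
    (pow_le_pow_left₀ (by positivity) hTT 4).trans (le_add_of_nonneg_right zero_le_one)
  -- `ε² ≤ Var² ≤ 4·81^T·T⁴·Inf ≤ 4·81^{T₀}·(T₀⁴+1)·Inf`
  have hK : 4 * (81 : ℝ) ^ T * (T : ℝ) ^ 4 * influence i p ≤
      4 * (81 : ℝ) ^ T₀ * ((T₀ : ℝ) ^ 4 + 1) * influence i p := by
    apply mul_le_mul_of_nonneg_right _ hInf
    exact mul_le_mul (mul_le_mul_of_nonneg_left h81 (by norm_num)) hT4 (by positivity) (by positivity)
  have hpos : (0 : ℝ) < 4 * (81 : ℝ) ^ T₀ * ((T₀ : ℝ) ^ 4 + 1) := by positivity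
  rw [one_div_mul_eq_div, div_le_iff₀ hpos]
  calc (ε / T) ^ 2 ≤ ε ^ 2 := hεT
    _ ≤ boolVariance p ^ 2 := hε2
    _ ≤ 4 * (81 : ℝ) ^ T * (T : ℝ) ^ 4 * influence i p := hi
    _ ≤ 4 * (81 : ℝ) ^ T₀ * ((T₀ : ℝ) ^ 4 + 1) * influence i p := hK
    _ = influence i p * (4 * (81 : ℝ) ^ T₀ * ((T₀ : ℝ) ^ 4 + 1)) := mul_comm _ _

/-- **On `Q_T` (`AA_Q` with the variance exponent `2`, every query count).**  For every quantum algorithm making `T`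
queries to `N` bits and every real polynomial `p` with `Q`'s acceptance probabilities as cube values: if
`Var[p] ≥ ε > 0` then some variable has `ε² ≤ 4·81^T·T⁴·Inf_i[p]` (the acceptance polynomial has total degree
`≤ 2T` and values in `[0,1]`: Beals et al. + unitarity, tree `exists_acceptPolynomial`). [cite: BealsEtAl2001, Lemma 4.2]
[cite: ODonnell2014, Thm. 9.21] [cite: AaronsonAmbainis2014, Conj. 6 and p. 6] -/
theorem aaQuery_var_sq (Q : QQueryAlg N) (p : MvPolynomial (Fin N) ℝ) {ε : ℝ}
    (hp : ∀ x, evalBool p x = Q.acceptProb x) (hε : 0 < ε) (hv : ε ≤ boolVariance p) :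
    ∃ i : Fin N, ε ^ 2 ≤ 4 * (81 : ℝ) ^ Q.queries * (Q.queries : ℝ) ^ 4 * influence i p := by
  rcases Nat.eq_zero_or_pos N with hN0 | hN
  · exfalso; subst hN0; linarith [show boolVariance p = 0 by simp [boolVariance, boolAvg]]
  obtain ⟨p₀, hdeg, hval⟩ := exists_acceptPolynomial Q
  have heq : evalBool p = evalBool p₀ := funext fun x => by rw [hp x]; exact hval x
  have hb : ∀ x, 0 ≤ evalBool p₀ x ∧ evalBool p₀ x ≤ 1 := fun x => by
    have hx : evalBool p₀ x = Q.acceptProb x := (hval x).symm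
    rw [hx]
    exact ⟨Q.acceptProb_nonneg x, Q.acceptProb_le_one' x⟩
  obtain ⟨i, hi⟩ := exists_influence_ge_var_sq hN hdeg hb
  refine ⟨i, ?_⟩
  have hinf : influence i p = influence i p₀ := by unfold influence; rw [heq]
  have hvar : boolVariance p = boolVariance p₀ := by unfold boolVariance; rw [heq]
  rw [hinf]
  rw [hvar] at hv
  have h81 : (9 : ℝ) ^ (2 * Q.queries) = (81 : ℝ) ^ Q.queries := by rw [pow_mul]; norm_num
  have hcast : ((2 * Q.queries : ℕ) : ℝ) ^ 4 = 16 * (Q.queries : ℝ) ^ 4 := by push_cast; ring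
  rw [h81, hcast] at hi
  have hε2 : ε ^ 2 ≤ boolVariance p₀ ^ 2 := pow_le_pow_left₀ hε.le hv 2
  linarith

/-- **`AA_Q` holds with the OPTIMAL exponent `c = 2` for boundedly many queries, every bound `T₀`.**  For each `T₀`
there is `C' > 0` (`C' = 1/(4·81^{T₀}·(T₀⁴+1))`) such that every polynomial with the cube values of a quantum algorithm
making `1 ≤ T ≤ T₀` queries and `Var ≥ ε > 0` has a variable with `C'·(ε/T)² ≤ Inf_i` — the shape of `AA_Q`
(`Theorems/SosSandwichQueryAAQCalibration.lean: aaQuery_of_queries_le`, there with the DFKO exponent; `…QueryAAQTwoQueries: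
aaQuery_of_queries_le_two` for `T₀ = 2`).  `c = 2` cannot be improved (`aaQuery_exponent_ge_two`), so the open content of
the crux is exactly the growth of `C'` in `T₀`. [cite: AaronsonAmbainis2014, Conj. 6 and p. 6] [cite: BealsEtAl2001, Lemma 4.2]
[cite: ODonnell2014, Thm. 9.21] -/
theorem aaQuery_of_queries_le_sharp (T₀ : ℕ) :
    ∃ C' : ℝ, 0 < C' ∧ ∀ (N : ℕ) (Q : QQueryAlg N) (p : MvPolynomial (Fin N) ℝ) (ε : ℝ),
      Q.queries ≤ T₀ → 1 ≤ Q.queries → (∀ x, evalBool p x = Q.acceptProb x) → 0 < ε → ε ≤ boolVariance p →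
        ∃ i : Fin N, C' * (ε / Q.queries) ^ 2 ≤ influence i p := by
  refine ⟨1 / (4 * (81 : ℝ) ^ T₀ * ((T₀ : ℝ) ^ 4 + 1)), by positivity, ?_⟩
  intro N Q p ε hT0 hT hp hε hv
  obtain ⟨i, hi⟩ := aaQuery_var_sq Q p hp hε hv
  refine ⟨i, ?_⟩
  have hInf := influence_nonneg i p
  have hT1 : (1 : ℝ) ≤ Q.queries := by exact_mod_cast hT
  have hTT : (Q.queries : ℝ) ≤ T₀ := by exact_mod_cast hT0
  have hεT : (ε / Q.queries) ^ 2 ≤ ε ^ 2 :=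
    pow_le_pow_left₀ (div_nonneg hε.le (by positivity)) (div_le_self hε.le hT1) 2
  have h81 : (81 : ℝ) ^ Q.queries ≤ (81 : ℝ) ^ T₀ := pow_le_pow_right₀ (by norm_num) hT0
  have hT4 : (Q.queries : ℝ) ^ 4 ≤ (T₀ : ℝ) ^ 4 + 1 :=
    (pow_le_pow_left₀ (by positivity) hTT 4).trans (le_add_of_nonneg_right zero_le_one)
  have hK : 4 * (81 : ℝ) ^ Q.queries * (Q.queries : ℝ) ^ 4 * influence i p ≤
      4 * (81 : ℝ) ^ T₀ * ((T₀ : ℝ) ^ 4 + 1) * influence i p := by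
    apply mul_le_mul_of_nonneg_right _ hInf
    exact mul_le_mul (mul_le_mul_of_nonneg_left h81 (by norm_num)) hT4 (by positivity) (by positivity)
  have hpos : (0 : ℝ) < 4 * (81 : ℝ) ^ T₀ * ((T₀ : ℝ) ^ 4 + 1) := by positivity
  rw [one_div_mul_eq_div, div_le_iff₀ hpos]
  calc (ε / Q.queries) ^ 2 ≤ ε ^ 2 := hεT
    _ ≤ 4 * (81 : ℝ) ^ Q.queries * (Q.queries : ℝ) ^ 4 * influence i p := hi
    _ ≤ 4 * (81 : ℝ) ^ T₀ * ((T₀ : ℝ) ^ 4 + 1) * influence i p := hK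
    _ = influence i p * (4 * (81 : ℝ) ^ T₀ * ((T₀ : ℝ) ^ 4 + 1)) := mul_comm _ _

/-! ### §4 The polynomial part of the chain: `4·Var[p] ≤ 2d² · E_x maxᵢ |p(x) - p(x^{⊕i})|` -/

/-- The total influence is the average over the cube of the sum of squared bit-flip differences. [cite: ODonnell2014, §2.3] -/
theorem sum_influence_eq_boolAvg (p : MvPolynomial (Fin N) ℝ) :
    ∑ j, influence j p = boolAvg (fun x => ∑ j, (evalBool p x - evalBool p (flipBit j x)) ^ 2) := by
  unfold influence boolAvg
  rw [← Finset.sum_div, Finset.sum_comm]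

/-- **Variance versus expected ℓ^∞-sensitivity — the loss-free part of the chain (polynomial in `d`).**  For a real
polynomial `p` of total degree `≤ d` with `0 ≤ p ≤ 1` on `{0,1}^N`, `N ≥ 1`, and ANY pointwise bound
`m(x) ≥ maxᵢ |p(x) - p(x^{⊕i})|`: `4·Var[p] ≤ 2d² · E_x m(x)` (Poincaré `4 Var ≤ Σ_i Inf_i = E_x Σ_i u_i(x)²`,
`u_i = p - p^{⊕i}`, and `Σ_i u_i(x)² ≤ m(x) · Σ_i |u_i(x)| ≤ 2d² · m(x)` by the ℓ¹-sensitivity bound).  Only the passage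
from `E_x maxᵢ |p - p^{⊕i}|` to `maxᵢ Inf_i` costs the factor `3^d` in `exists_influence_ge_var_sq`; with `m ≡ 1` this is
the tree's `Σ_i Inf_i ≤ 2d²`-type bound, with `m(x) = maxᵢ |u_i(x)|` it isolates what an Aaronson–Ambainis-strength bound
would still need. [cite: ODonnell2014, §2.3] [cite: Korneichuk1991, Thm 3.5.8 (§3.5.4)] [cite: AaronsonAmbainis2014, Conj. 6] -/
theorem four_mul_boolVariance_le_avg_maxFlip {d : ℕ} {p : MvPolynomial (Fin N) ℝ} (hN : 0 < N)
    (hp : p.totalDegree ≤ d) (hb : ∀ x, 0 ≤ evalBool p x ∧ evalBool p x ≤ 1) {m : (Fin N → Bool) → ℝ}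
    (hm : ∀ x i, |evalBool p x - evalBool p (flipBit i x)| ≤ m x) :
    4 * boolVariance p ≤ 2 * (d : ℝ) ^ 2 * boolAvg m := by
  -- Poincaré `4·Var ≤ Σ_i Inf_i` (as in `exists_influence_ge_var_sq`)
  have hP : 4 * boolVariance p ≤ ∑ j, influence j p := by
    rw [sum_influence_eq, boolVariance_eq_tailWeight_one, tailWeight]
    refine mul_le_mul_of_nonneg_left ?_ (by norm_num)
    calc ∑ S ∈ univ.filter (fun S : Finset (Fin N) => 1 ≤ S.card), cubeFourierCoeff (evalBool p) S ^ 2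
        ≤ ∑ S ∈ univ.filter (fun S : Finset (Fin N) => 1 ≤ S.card),
            (S.card : ℝ) * cubeFourierCoeff (evalBool p) S ^ 2 :=
          Finset.sum_le_sum fun S hS => by
            have h1 : (1 : ℝ) ≤ S.card := by exact_mod_cast (Finset.mem_filter.1 hS).2
            nlinarith [sq_nonneg (cubeFourierCoeff (evalBool p) S)]
      _ ≤ ∑ S, (S.card : ℝ) * cubeFourierCoeff (evalBool p) S ^ 2 :=
          Finset.sum_le_sum_of_subset_of_nonneg (Finset.filter_subset _ _) fun S _ _ => by positivity
  have hm0 : ∀ x, 0 ≤ m x := fun x => (abs_nonneg _).trans (hm x ⟨0, hN⟩)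
  -- pointwise: `Σ_j u_j(x)² ≤ m(x) · Σ_j |u_j(x)| ≤ 2d² · m(x)`
  have hpt : ∀ x, ∑ j, (evalBool p x - evalBool p (flipBit j x)) ^ 2 ≤ 2 * (d : ℝ) ^ 2 * m x := by
    intro x
    calc ∑ j, (evalBool p x - evalBool p (flipBit j x)) ^ 2
        = ∑ j, |evalBool p x - evalBool p (flipBit j x)| * |evalBool p x - evalBool p (flipBit j x)| :=
          Finset.sum_congr rfl fun j _ => by rw [← sq, sq_abs]
      _ ≤ ∑ j, m x * |evalBool p x - evalBool p (flipBit j x)| :=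
          Finset.sum_le_sum fun j _ => mul_le_mul_of_nonneg_right (hm x j) (abs_nonneg _)
      _ = m x * ∑ j, |evalBool p x - evalBool p (flipBit j x)| := by rw [Finset.mul_sum]
      _ ≤ m x * (2 * (d : ℝ) ^ 2) :=
          mul_le_mul_of_nonneg_left (sum_abs_sub_flipBit_le_of_bounded hp hb x) (hm0 x)
      _ = 2 * (d : ℝ) ^ 2 * m x := by ring
  have havg : boolAvg (fun x => ∑ j, (evalBool p x - evalBool p (flipBit j x)) ^ 2) ≤
      boolAvg (fun x => 2 * (d : ℝ) ^ 2 * m x) := by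
    unfold boolAvg
    exact div_le_div_of_nonneg_right (Finset.sum_le_sum fun x _ => hpt x) (by positivity)
  have hlin : boolAvg (fun x => 2 * (d : ℝ) ^ 2 * m x) = 2 * (d : ℝ) ^ 2 * boolAvg m := by
    unfold boolAvg
    rw [← Finset.mul_sum, mul_div_assoc]
  rw [sum_influence_eq_boolAvg] at hP
  linarith

end Summit.QuantumAdvantage.QuantumAdvantage.Theorems.SosSandwich.VarianceSquared

end
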